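import Summits.Ventures.LatticeQCDFlow.Scaling.ReplicaExchangeModeTorpid
import Summits.Ventures.LatticeQCDFlow.Scaling.ReplicaExchangeBareSampler

/-!
HONEST FRAMING: exact (Metropolis-corrected) sampling algorithms for lattice gauge theory; figures
of merit are autocorrelation/cost numbers at stated couplings and volumes; no continuum-physics
claim.

# AdjacentSchemeDiffusiveCeiling — NO ADJACENT EXCHANGE SCHEME BEATS DIFFUSION: FOR `P = t·Q + (1−t)·Upd` WITH `Q`
# ANY `π̃`-REVERSIBLE MOVE THAT PERMUTES THE REPLICAS' SECTOR LABELS BY ONE ADJACENT TRANSPOSITION AT A TIME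
# (bare swaps, map-assisted swaps with sector-preserving maps, any acceptance rule, any schedule of neighbouring pairs),
# OVER SECTOR-FROZEN COLD REPLICAS `Gap(P) ≤ 3t/(v·K(K+1)(2K+1))` — ORDER `K⁻³` (lean-2 GEN-19, ours)

Venture-side (OURS).  Cell `lqcd-flow` (pub-lqcd), unit `pub-lqcd-lean-2-g19`, 2026-08-25.  Chapter R, the universal
form of the diffusive ceiling of `Scaling/ReplicaExchangeDiffusive` (there for the bare Metropolis ladder).  Setting
of `Scaling/ExchangeSchemeSectorCeiling`: state space `Fin (K+1) → S`, law `π̃ = ⊗_k μ_k`, update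
`Upd = prodKernel (1/(K+1)) M`; an ADJACENT EXCHANGE MOVE is a row-stochastic `π̃`-reversible kernel `Q` such that
`Q(x,y) > 0`, `y ≠ x` ⇒ for some `j < K` the sector labels `(1_A(y_k))_k` are those of `x` with levels `j, j+1`
exchanged.  Test function: the LINEAR PROFILE COUNT `G(x) = Σ_k k·f_A^{(μ_k)}(x_k)`.

## What is proved

* §1 `linearCount_mean` (`= 0`), `linearCount_piInner`
  (`= Σ_k k²μ_k(A)μ_k(Aᶜ)`), `linearCount_piInner_ge` (`≥ v·K(K+1)(2K+1)/6` when `μ_k(A)μ_k(Aᶜ) ≥ v`, `k ≥ 1`);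
  `prodUpdate_dirichletForm_linearCount` (`= (1/(K+1))Σ_k k²Q_k(A,Aᶜ)`); `linearCount_sub_of_adjacent`,
  `adjacent_dirichletForm_linearCount_le` (`𝓔_π̃(Q; G) ≤ ½`).
* §2 **`adjacentScheme_spectralGap_le`** — `Gap(P) ≤ (t/2 + ((1−t)/(K+1))Σ_k k²Q_k(A,Aᶜ))/Σ_k k²μ_k(A)μ_k(Aᶜ)`;
  **`adjacentSchemeFrozen_spectralGap_le`** — sector-frozen cold replicas: `Gap(P) ≤ 3t/(v·K(K+1)(2K+1))`.

Reading (no numerics implied): on the adjacent ladder a sector label diffuses one level per accepted exchange, and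
no map, acceptance rule or pair schedule changes that: `Θ(K³)` steps (the matching floor for the direct conveyor is
`Scaling/ReplicaExchangeFrozenColdDirect`); the hub topologies of `Scaling/ReplicaExchangeStarFloor` are the way to
`Θ(K²)`, and `Scaling/ExchangeSchemeSectorCeiling` says nothing exchanges faster than that.  NOT CLAIMED: schemes
moving a label by more than one level per step (covered only by the `K²` ceiling); anything measured.  Literature
grade (cell rule): KNOWN MECHANISM (test-function ceilings), NEW TYPING (universal over adjacent schemes); nothing
cited as a fact; no new bib keys.
-/

noncomputable section

open Finset Function
open Literature.Probability.MarkovChains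

namespace Summit.Ventures.LatticeQCDFlow.Scaling

variable {S : Type*} [Fintype S] [DecidableEq S] {K : ℕ} {μ : Fin (K + 1) → S → ℝ}
  {M : Fin (K + 1) → S → S → ℝ} {t : ℝ}

/-! ## §1 The linear profile count -/

/-- **The linear count is centred under `π̃`.** [ours] -/
theorem linearCount_mean (hμ1 : ∀ k, ∑ u, μ k u = 1) (A : Finset S) :
    ∑ x : Fin (K + 1) → S, tensorFun μ x * ∑ k : Fin (K + 1), ((k : ℕ) : ℝ) * bottleneckTestFun (μ k) A (x k) = 0 := by
  rw [sum_tensorFun_mul_additive μ hμ1 (fun k u => ((k : ℕ) : ℝ) * bottleneckTestFun (μ k) A u)]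
  refine Finset.sum_eq_zero fun k _ => ?_
  have e : ∑ u, μ k u * (((k : ℕ) : ℝ) * bottleneckTestFun (μ k) A u)
      = ((k : ℕ) : ℝ) * ∑ u, μ k u * bottleneckTestFun (μ k) A u := by
    rw [Finset.mul_sum]; exact sum_congr rfl fun u _ => by ring
  rw [e, sum_mul_bottleneckTestFun, mul_zero]

/-- **`‖G‖²_π̃ = Σ_k k²·μ_k(A)μ_k(Aᶜ)`.** [ours] -/
theorem linearCount_piInner (hμ1 : ∀ k, ∑ u, μ k u = 1) (A : Finset S) :
    piInner (tensorFun μ) (fun x => ∑ k : Fin (K + 1), ((k : ℕ) : ℝ) * bottleneckTestFun (μ k) A (x k))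
        (fun x => ∑ k : Fin (K + 1), ((k : ℕ) : ℝ) * bottleneckTestFun (μ k) A (x k))
      = ∑ k : Fin (K + 1), ((k : ℕ) : ℝ) ^ 2 * ((∑ u ∈ A, μ k u) * ∑ u ∈ Aᶜ, μ k u) := by
  have h := piInner_tensorFun_additive μ hμ1 (fun k u => ((k : ℕ) : ℝ) * bottleneckTestFun (μ k) A u) (fun k => by
    have e : ∑ u, μ k u * (((k : ℕ) : ℝ) * bottleneckTestFun (μ k) A u)
        = ((k : ℕ) : ℝ) * ∑ u, μ k u * bottleneckTestFun (μ k) A u := by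
      rw [Finset.mul_sum]; exact sum_congr rfl fun u _ => by ring
    rw [e, sum_mul_bottleneckTestFun, mul_zero])
  rw [h]
  refine sum_congr rfl fun k _ => ?_
  rw [← piInner_bottleneckTestFun (hμ1 k) A]
  unfold piInner
  rw [Finset.mul_sum]
  exact sum_congr rfl fun u _ => by ring

/-- **`‖G‖²_π̃ ≥ v·K(K+1)(2K+1)/6`** when every cold level has `μ_k(A)μ_k(Aᶜ) ≥ v` (`k ≥ 1`; nonnegative laws). [ours] -/
theorem linearCount_piInner_ge (hμ1 : ∀ k, ∑ u, μ k u = 1) (A : Finset S) {v : ℝ}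
    (hv : ∀ k : Fin (K + 1), k ≠ 0 → v ≤ (∑ u ∈ A, μ k u) * ∑ u ∈ Aᶜ, μ k u) :
    v * (K * (K + 1) * (2 * K + 1) / 6)
      ≤ piInner (tensorFun μ) (fun x => ∑ k : Fin (K + 1), ((k : ℕ) : ℝ) * bottleneckTestFun (μ k) A (x k))
          (fun x => ∑ k : Fin (K + 1), ((k : ℕ) : ℝ) * bottleneckTestFun (μ k) A (x k)) := by
  have hsq : ∀ n : ℕ, ∑ i ∈ Finset.range (n + 1), ((i : ℕ) : ℝ) ^ 2 = n * (n + 1) * (2 * n + 1) / 6 := by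
    intro n
    induction n with
    | zero => simp
    | succ m ih =>
        rw [Finset.sum_range_succ, ih]
        push_cast
        ring
  have hK : ∑ k : Fin (K + 1), ((k : ℕ) : ℝ) ^ 2 = K * (K + 1) * (2 * K + 1) / 6 := by
    rw [Fin.sum_univ_eq_sum_range (fun i => ((i : ℕ) : ℝ) ^ 2) (K + 1), hsq]
  rw [linearCount_piInner hμ1, ← hK, Finset.mul_sum]
  refine sum_le_sum fun k _ => ?_
  by_cases hk : k = 0
  · subst hk; simp
  · have h0 : 0 ≤ ((k : ℕ) : ℝ) ^ 2 := sq_nonneg _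
    calc v * ((k : ℕ) : ℝ) ^ 2 = ((k : ℕ) : ℝ) ^ 2 * v := mul_comm _ _
      _ ≤ ((k : ℕ) : ℝ) ^ 2 * ((∑ u ∈ A, μ k u) * ∑ u ∈ Aᶜ, μ k u) := mul_le_mul_of_nonneg_left (hv k hk) h0

/-- **The update's Dirichlet form of the linear count:** `𝓔_π̃(Upd; G) = (1/(K+1))Σ_k k²Q_k(A,Aᶜ)`. [ours] -/
theorem prodUpdate_dirichletForm_linearCount (hμ1 : ∀ k, ∑ u, μ k u = 1) (hM : ∀ k, IsRowStochastic (M k))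
    (hMrev : ∀ k, DetailedBalance (μ k) (M k)) (A : Finset S) :
    dirichletForm (tensorFun μ) (prodKernel (fun _ : Fin (K + 1) => (1 : ℝ) / (K + 1)) M)
        (fun x => ∑ k : Fin (K + 1), ((k : ℕ) : ℝ) * bottleneckTestFun (μ k) A (x k))
      = 1 / (K + 1) * ∑ k : Fin (K + 1), ((k : ℕ) : ℝ) ^ 2 * edgeMeasure (μ k) (M k) A Aᶜ := by
  rw [dirichletForm_prodKernel_additive μ hμ1 (fun _ : Fin (K + 1) => (1 : ℝ) / (K + 1)) M
    (fun k u => ((k : ℕ) : ℝ) * bottleneckTestFun (μ k) A u), Finset.mul_sum]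
  refine sum_congr rfl fun k _ => ?_
  rw [dirichletForm_smul, dirichletForm_bottleneckTestFun (hM k) ((hMrev k).isStationary (hM k).2) (hμ1 k) A]

omit [Fintype S] in
/-- **One adjacent transposition of the sector labels changes the linear count by at most one:** if the labels of
`y` are those of `x` with levels `j, j+1` exchanged then `(G(x) − G(y))² ≤ 1`. [ours] -/
theorem linearCount_sub_of_adjacent [Fintype S] (hμ1 : ∀ k, ∑ u, μ k u = 1) (A : Finset S)
    {x y : Fin (K + 1) → S} {j : Fin K}
    (hxy : ∀ k, (y k ∈ A ↔ x (levelSwap j k) ∈ A)) :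
    ((∑ k : Fin (K + 1), ((k : ℕ) : ℝ) * bottleneckTestFun (μ k) A (x k))
        - ∑ k : Fin (K + 1), ((k : ℕ) : ℝ) * bottleneckTestFun (μ k) A (y k)) ^ 2 ≤ 1 := by
  have hne : j.castSucc ≠ j.succ := ne_of_lt Fin.castSucc_lt_succ
  set I : Fin (K + 1) → ℝ := fun k => if x k ∈ A then (0 : ℝ) else 1 with hI
  have hI01 : ∀ k, I k = 0 ∨ I k = 1 := fun k => by rw [hI]; simp only; split_ifs <;> simp
  have hy : ∀ k, (if y k ∈ A then (0 : ℝ) else 1) = I (levelSwap j k) := by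
    intro k
    rw [hI]; simp only
    by_cases h : y k ∈ A
    · rw [if_pos h, if_pos ((hxy k).mp h)]
    · rw [if_neg h, if_neg (fun h' => h ((hxy k).mpr h'))]
  -- the difference is `Σ_k k·(I_k − I_{σ_j k}) = I_{j+1} − I_j`
  have hdiff : (∑ k : Fin (K + 1), ((k : ℕ) : ℝ) * bottleneckTestFun (μ k) A (x k))
      - ∑ k : Fin (K + 1), ((k : ℕ) : ℝ) * bottleneckTestFun (μ k) A (y k)
      = ∑ k : Fin (K + 1), ((k : ℕ) : ℝ) * (I k - I (levelSwap j k)) := by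
    simp_rw [bottleneckTestFun_eq (hμ1 _), hy]
    rw [← Finset.sum_sub_distrib]
    refine sum_congr rfl fun k _ => ?_
    rw [hI]; simp only; ring
  have hsum : ∑ k : Fin (K + 1), ((k : ℕ) : ℝ) * (I k - I (levelSwap j k)) = I j.succ - I j.castSucc := by
    rw [Fintype.sum_eq_add j.castSucc j.succ hne (fun k hk => by
      unfold levelSwap; rw [Equiv.swap_apply_of_ne_of_ne hk.1 hk.2, sub_self, mul_zero])]
    unfold levelSwap
    rw [Equiv.swap_apply_left, Equiv.swap_apply_right]
    have hj : ((j.succ : ℕ) : ℝ) = ((j.castSucc : ℕ) : ℝ) + 1 := by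
      rw [Fin.val_succ, Fin.val_castSucc]; push_cast; ring
    rw [hj]; ring
  rw [hdiff, hsum]
  rcases hI01 j.succ with h1 | h1 <;> rcases hI01 j.castSucc with h2 | h2 <;> rw [h1, h2] <;> norm_num

/-- **An adjacent exchange move has `𝓔_π̃(Q; G) ≤ ½`.** [ours] -/
theorem adjacent_dirichletForm_linearCount_le (hμ0 : ∀ k u, 0 ≤ μ k u) (hμ1 : ∀ k, ∑ u, μ k u = 1)
    {Q : Matrix (Fin (K + 1) → S) (Fin (K + 1) → S) ℝ} (hQ : IsRowStochastic Q) (A : Finset S)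
    (hQadj : ∀ x y, Q x y ≠ 0 → y ≠ x → ∃ j : Fin K, ∀ k, (y k ∈ A ↔ x (levelSwap j k) ∈ A)) :
    dirichletForm (tensorFun μ) Q (fun x => ∑ k : Fin (K + 1), ((k : ℕ) : ℝ) * bottleneckTestFun (μ k) A (x k)) ≤ 1 / 2 := by
  unfold dirichletForm
  have hπ0 : ∀ x, 0 ≤ tensorFun μ x := fun x => prod_nonneg fun k _ => hμ0 k (x k)
  have hterm : ∀ x y, tensorFun μ x * Q x y
      * ((∑ k : Fin (K + 1), ((k : ℕ) : ℝ) * bottleneckTestFun (μ k) A (x k))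
          - ∑ k : Fin (K + 1), ((k : ℕ) : ℝ) * bottleneckTestFun (μ k) A (y k)) ^ 2
        ≤ tensorFun μ x * Q x y := by
    intro x y
    have hw : 0 ≤ tensorFun μ x * Q x y := mul_nonneg (hπ0 x) (hQ.1 x y)
    by_cases hq : Q x y = 0
    · rw [hq, mul_zero, zero_mul]
    · by_cases hyx : y = x
      · subst hyx
        rw [sub_self, zero_pow two_ne_zero, mul_zero]; exact hw
      · obtain ⟨j, hj⟩ := hQadj x y hq hyx
        have h1 := linearCount_sub_of_adjacent (μ := μ) hμ1 A hj
        nlinarith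
  calc (1 / 2 : ℝ) * ∑ x, ∑ y, tensorFun μ x * Q x y
        * ((∑ k : Fin (K + 1), ((k : ℕ) : ℝ) * bottleneckTestFun (μ k) A (x k))
            - ∑ k : Fin (K + 1), ((k : ℕ) : ℝ) * bottleneckTestFun (μ k) A (y k)) ^ 2
      ≤ (1 / 2) * ∑ x, ∑ y, tensorFun μ x * Q x y :=
        mul_le_mul_of_nonneg_left (sum_le_sum fun x _ => sum_le_sum fun y _ => hterm x y) (by norm_num)
    _ = 1 / 2 := by
        have e : ∑ x, ∑ y, tensorFun μ x * Q x y = 1 := by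
          simp_rw [← Finset.mul_sum]
          simp_rw [hQ.2, mul_one]
          exact sum_tensorFun_eq_one μ hμ1
        rw [e, mul_one]

/-! ## §2 The universal diffusive ceiling -/

/-- **NO ADJACENT EXCHANGE SCHEME BEATS DIFFUSION (general form):** for any row-stochastic `π̃`-reversible adjacent
exchange move `Q`, `0 ≤ t ≤ 1`, `|S| ≥ 2`, `Σ_k k²μ_k(A)μ_k(Aᶜ) > 0`:
`Gap(tQ + (1−t)Upd) ≤ (t/2 + ((1−t)/(K+1))Σ_k k²Q_k(A,Aᶜ))/Σ_k k²μ_k(A)μ_k(Aᶜ)`. [ours] -/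
theorem adjacentScheme_spectralGap_le [Nontrivial S] (hμ : ∀ k x, 0 < μ k x) (hμ1 : ∀ k, ∑ u, μ k u = 1)
    (hM : ∀ k, IsRowStochastic (M k)) (hMrev : ∀ k, DetailedBalance (μ k) (M k)) (ht0 : 0 ≤ t) (ht1 : t ≤ 1)
    {Q : Matrix (Fin (K + 1) → S) (Fin (K + 1) → S) ℝ} (hQ : IsRowStochastic Q)
    (hQrev : DetailedBalance (tensorFun μ) Q) {A : Finset S}
    (hQadj : ∀ x y, Q x y ≠ 0 → y ≠ x → ∃ j : Fin K, ∀ k, (y k ∈ A ↔ x (levelSwap j k) ∈ A))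
    (hA : 0 < ∑ k : Fin (K + 1), ((k : ℕ) : ℝ) ^ 2 * ((∑ u ∈ A, μ k u) * ∑ u ∈ Aᶜ, μ k u)) :
    spectralGap (tensorFun μ)
        (fun x y => t * Q x y + (1 - t) * prodKernel (fun _ : Fin (K + 1) => (1 : ℝ) / (K + 1)) M x y)
      ≤ (t / 2 + (1 - t) / (K + 1) * ∑ k : Fin (K + 1), ((k : ℕ) : ℝ) ^ 2 * edgeMeasure (μ k) (M k) A Aᶜ)
          / ∑ k : Fin (K + 1), ((k : ℕ) : ℝ) ^ 2 * ((∑ u ∈ A, μ k u) * ∑ u ∈ Aᶜ, μ k u) := by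
  set U := prodKernel (fun _ : Fin (K + 1) => (1 : ℝ) / (K + 1)) M with hUdef
  have hUst := prodKernel_isRowStochastic M (fun _ : Fin (K + 1) => (1 : ℝ) / (K + 1)) (fun _ => by positivity)
    (sum_uniform_weight K) hM
  have hUrev := prodKernel_detailedBalance (π := μ) hMrev (fun _ : Fin (K + 1) => (1 : ℝ) / (K + 1))
  have hP : IsRowStochastic (fun x y : Fin (K + 1) → S => t * Q x y + (1 - t) * U x y) := by
    refine ⟨fun x y => add_nonneg (mul_nonneg ht0 (hQ.1 x y)) (mul_nonneg (by linarith) (hUst.1 x y)), fun x => ?_⟩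
    simp only
    rw [Finset.sum_add_distrib, ← Finset.mul_sum, ← Finset.mul_sum, hQ.2 x, hUst.2 x]; ring
  have hDB : DetailedBalance (tensorFun μ) (fun x y : Fin (K + 1) → S => t * Q x y + (1 - t) * U x y) := by
    intro x y
    have h1 := hQrev x y
    have h2 := hUrev x y
    simp only
    calc tensorFun μ x * (t * Q x y + (1 - t) * U x y)
        = t * (tensorFun μ x * Q x y) + (1 - t) * (tensorFun μ x * U x y) := by ring
      _ = t * (tensorFun μ y * Q y x) + (1 - t) * (tensorFun μ y * U y x) := by rw [h1, h2]
      _ = _ := by ring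
  -- the Dirichlet form of the mixture splits
  have hsplit : dirichletForm (tensorFun μ) (fun x y : Fin (K + 1) → S => t * Q x y + (1 - t) * U x y)
      (fun x => ∑ k : Fin (K + 1), ((k : ℕ) : ℝ) * bottleneckTestFun (μ k) A (x k))
      = t * dirichletForm (tensorFun μ) Q (fun x => ∑ k : Fin (K + 1), ((k : ℕ) : ℝ) * bottleneckTestFun (μ k) A (x k))
        + (1 - t) * dirichletForm (tensorFun μ) U (fun x => ∑ k : Fin (K + 1), ((k : ℕ) : ℝ) * bottleneckTestFun (μ k) A (x k)) := by
    unfold dirichletForm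
    rw [← mul_assoc, ← mul_assoc, mul_comm t, mul_comm (1 - t), mul_assoc, mul_assoc, ← mul_add]
    congr 1
    rw [Finset.mul_sum, Finset.mul_sum, ← Finset.sum_add_distrib]
    refine sum_congr rfl fun x _ => ?_
    rw [Finset.mul_sum, Finset.mul_sum, ← Finset.sum_add_distrib]
    exact sum_congr rfl fun y _ => by ring
  have hray := LevinPeres2017_lemma_13_7_rayleigh (tensorFun_pos hμ) (sum_tensorFun_eq_one μ hμ1) hP hDB
    (linearCount_mean (μ := μ) hμ1 A)
  rw [linearCount_piInner hμ1, hsplit, hUdef, prodUpdate_dirichletForm_linearCount hμ1 hM hMrev] at hray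
  have hsw := adjacent_dirichletForm_linearCount_le (μ := μ) (fun k u => (hμ k u).le) hμ1 hQ A hQadj
  rw [le_div_iff₀ hA]
  calc spectralGap (tensorFun μ) (fun x y => t * Q x y + (1 - t) * U x y)
        * ∑ k : Fin (K + 1), ((k : ℕ) : ℝ) ^ 2 * ((∑ u ∈ A, μ k u) * ∑ u ∈ Aᶜ, μ k u)
      ≤ t * dirichletForm (tensorFun μ) Q (fun x => ∑ k : Fin (K + 1), ((k : ℕ) : ℝ) * bottleneckTestFun (μ k) A (x k))
        + (1 - t) * (1 / (K + 1) * ∑ k : Fin (K + 1), ((k : ℕ) : ℝ) ^ 2 * edgeMeasure (μ k) (M k) A Aᶜ) := hray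
    _ ≤ t * (1 / 2) + (1 - t) * (1 / (K + 1) * ∑ k : Fin (K + 1), ((k : ℕ) : ℝ) ^ 2 * edgeMeasure (μ k) (M k) A Aᶜ) := by
        have := mul_le_mul_of_nonneg_left hsw ht0
        linarith
    _ = t / 2 + (1 - t) / (K + 1) * ∑ k : Fin (K + 1), ((k : ℕ) : ℝ) ^ 2 * edgeMeasure (μ k) (M k) A Aᶜ := by ring

/-- **NO ADJACENT EXCHANGE SCHEME BEATS DIFFUSION: `Gap ≤ 3t/(v·K(K+1)(2K+1))`** over sector-frozen cold replicas
(`Q_k(A,Aᶜ) = 0` and `μ_k(A)μ_k(Aᶜ) ≥ v > 0` for `k ≥ 1`; `K ≥ 1`, `0 ≤ t ≤ 1`, `|S| ≥ 2`), for ANY adjacent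
exchange move — order `K⁻³`. [ours] -/
theorem adjacentSchemeFrozen_spectralGap_le [Nontrivial S] (hK : 1 ≤ K) (hμ : ∀ k x, 0 < μ k x)
    (hμ1 : ∀ k, ∑ u, μ k u = 1) (hM : ∀ k, IsRowStochastic (M k)) (hMrev : ∀ k, DetailedBalance (μ k) (M k))
    (ht0 : 0 ≤ t) (ht1 : t ≤ 1) {Q : Matrix (Fin (K + 1) → S) (Fin (K + 1) → S) ℝ} (hQ : IsRowStochastic Q)
    (hQrev : DetailedBalance (tensorFun μ) Q) {A : Finset S}
    (hQadj : ∀ x y, Q x y ≠ 0 → y ≠ x → ∃ j : Fin K, ∀ k, (y k ∈ A ↔ x (levelSwap j k) ∈ A))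
    {v : ℝ} (hvpos : 0 < v) (hv : ∀ k : Fin (K + 1), k ≠ 0 → v ≤ (∑ u ∈ A, μ k u) * ∑ u ∈ Aᶜ, μ k u)
    (hfrozen : ∀ k : Fin (K + 1), k ≠ 0 → edgeMeasure (μ k) (M k) A Aᶜ = 0) :
    spectralGap (tensorFun μ)
        (fun x y => t * Q x y + (1 - t) * prodKernel (fun _ : Fin (K + 1) => (1 : ℝ) / (K + 1)) M x y)
      ≤ 3 * t / (v * (K * (K + 1) * (2 * K + 1))) := by
  have hKpos : (0 : ℝ) < K := Nat.cast_pos.mpr (by omega)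
  have hVge := linearCount_piInner_ge (μ := μ) hμ1 A hv
  rw [linearCount_piInner hμ1] at hVge
  have hS6 : 0 < v * (K * (K + 1) * (2 * K + 1) / 6) := by positivity
  have hA : 0 < ∑ k : Fin (K + 1), ((k : ℕ) : ℝ) ^ 2 * ((∑ u ∈ A, μ k u) * ∑ u ∈ Aᶜ, μ k u) := lt_of_lt_of_le hS6 hVge
  have h := adjacentScheme_spectralGap_le (t := t) (M := M) hμ hμ1 hM hMrev ht0 ht1 hQ hQrev hQadj hA
  -- the cold exit flows vanish and the hot one carries weight `0² = 0`
  have hQsum : ∑ k : Fin (K + 1), ((k : ℕ) : ℝ) ^ 2 * edgeMeasure (μ k) (M k) A Aᶜ = 0 := by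
    refine Finset.sum_eq_zero fun k _ => ?_
    by_cases hk : k = 0
    · subst hk; simp
    · rw [hfrozen k hk, mul_zero]
  rw [hQsum, mul_zero, add_zero] at h
  calc spectralGap (tensorFun μ)
        (fun x y => t * Q x y + (1 - t) * prodKernel (fun _ : Fin (K + 1) => (1 : ℝ) / (K + 1)) M x y)
      ≤ (t / 2) / ∑ k : Fin (K + 1), ((k : ℕ) : ℝ) ^ 2 * ((∑ u ∈ A, μ k u) * ∑ u ∈ Aᶜ, μ k u) := h
    _ ≤ (t / 2) / (v * (K * (K + 1) * (2 * K + 1) / 6)) :=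
        div_le_div_of_nonneg_left (by positivity) hS6 hVge
    _ = 3 * t / (v * (K * (K + 1) * (2 * K + 1))) := by
        field_simp
        ring

end Summit.Ventures.LatticeQCDFlow.Scaling

end
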